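import Summits.QuantumFields.BalabanUV.T4Continuum.Support.NE7CurvedRemainderCodifferential
import Summits.QuantumFields.BalabanUV.T4Continuum.Support.NE7CovariantInteriorGradientSharp
import Summits.QuantumFields.BalabanUV.T4Continuum.Support.NE7GradientCurrencyCurved
import HarnessLib

/-!
# NE7GradientCurrencyCurvedSharp — THE GRADIENT CURRENCY AT A CURVED BACKGROUND WITH THE LEVEL-UNIFORM GAIN: F121 re-assembled on the SHARP interior estimate F116b, so that
# the curvature of `W` enters through `R·δ·ρ` (`δ = 2d²(R+1)x₁ + 8d³(R+1)²x²`, the class's plaquette-GRADIENT radius `x₁`) and `R·a²·ρ`, `a·ρ` (`a = 2d(R+1)x`) — at `R = M` every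
# zeroth-order term is `O(ρ∕M)·(M²x₁·M + M³x² + M²x∕M …)`-small — instead of F121's `R²·x·ρ = O(M²x·ρ)`: for unitary `Per`-periodic `W` (plaquettes within `x`, covariant plaquette
# gradients within `x₁`), `Per`-periodic `Z` with `‖Z‖ ≤ ρ`, data `J` (relative-plaquette co-differential), `P` (divergence gradient), `R ≥ 1` with
# `16dR·a + 32dR(e^{4ρ}−1) ≤ 1`: `‖∇_W Z‖ ≤ 4(dρ∕R + R(J + P)) + (4R(8d(e^{4ρ}−1)x + 10dx + 2δ + 12da²) + 4a)·ρ` (+ `2xρ` in F115's form); file 52b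

Cell `pub-balaban`, rung (B)+1 sub-cell t4, lineage `b2b-balaban-t4-ne7-p1` (CRUX PROVER NE7 #1 = OWNER of row NE7), generation 79; memo
`t4/b2b-balaban-t4-ne7-p1-g79/GRADIENT-LETTER.md` §4.  File F121b (over F116b `NE7CovariantInteriorGradientSharp.norm_cD_le_of_covLap_sharp`, F121 `NE7GradientCurrencyCurved`
(`norm_covLap_frame_le`, `norm_gradMember_le_covFd`), `NE3CovariantWeitzenbock`, `NE3CovariantCalculus.cD_periodic`).
WHY (memo §4, the currency line of the (APE) bootstrap).  With the flat slice solver `K_G ≍ M` ((152)), every density F78 multiplies by `K_G` must be `O(δ·small∕M³)`; the gradient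
member enters as `K_G·α₀·α₁`, so `α₁` must be ONE POWER OF `M` below `α₀ ≍ δ∕M` up to level-uniform smalls.  F121's curvature term `(4d²R + 15d)·x·ρ·R ∋ 4d²R²xρ` is, at
`R = M`, `O(M²x)·ρ` — level-uniform but without the power of `M`.  F116b's bookkeeping (pub-balaban-gaps ne3's census R39: the transport defects pair into the commutator with the
axial-gauge divergence, controlled by `x₁`) repairs exactly this; the rest of F121's chain (F117 covariant Hodge, F119∕F120 factorisation and remainder co-differential, torus
absorption) is unchanged and used BY NAME.
WHAT ([folklore]; 0 def, 0 sorry).  §1 `norm_cD_frame_le_apriori_sharp`.  §2 **`norm_cD_frame_le_periodic_sharp`** (torus; the `G`-terms `8Rda·G + 16dR(e^{4ρ}−1)·G` absorbed).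
§3 **`norm_covFd_le_periodic_sharp`**, **`norm_gradMember_le_periodic_sharp`** (F115's `hGradZ` quantity, `+ 2xρ`).
HONEST FRAMING (page 1): elementary lattice analysis of OUR objects; `J`, `P` HYPOTHESES; nothing of Bałaban's asserted; (APE) on curved data NOT proved unconditionally; NOT ONE-STEP,
NOT NE7; spine 0∕9; finite T⁴ rung (B)+1 — NOT infinite volume, NOT mass gap, NOT `BetaPertH`, NOT Clay.  Continuum YM on T⁴ ⇐ BetaPertH ∧ nine spine estimates (0/9 proved);
BetaPertH ⇐ (D1) ∧ (D4) ∧ CAP+tail; G-an2-4 gates asym, D1 and NE2/3/4.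
-/

set_option autoImplicit false

open scoped BigOperators Matrix Matrix.Norms.L2Operator
open NormedSpace Finset

namespace Summit.QuantumFields.BalabanUV.T4Continuum.NE7GradientCurrencyCurvedSharp

open Literature.MathematicalPhysics.QuantumFieldTheory.Balaban1983to89
open B7Prop1Explicit B7Prop2Explicit
open T4AveragingDeficitWall (Ad IsUnitaryCfg SmallField vary)
open T4AveragingDeficitWallBoundary (IsPeriodicCfg periodBox mem_periodBox)
open AveragingDeficitPeriodicCounting (IsPeriodicDir)
open AveragingDeficitTorusChart (periodic_smul_vec)
open SkeletonLattice (cmod smul_cdiv_add_cmod cmod_nonneg cmod_lt)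
open T4AveragingDeficitNonAbelian (Ad_mul Ad_sub)
open AveragingDeficitTransport (norm_Ad_of_unitary)
open AveragingDeficitCovGrad (covFd units_id₁ norm_Ad_inv_sub_le)
open NE3CovariantCalculus (cD cDstar cD_periodic)
open NE3CovariantWeitzenbock (frame cD_frame cdiv_frame covDiv norm_frame frame_periodic)
open NE7CovariantHodgeBond (norm_covLap_le_hodge norm_hol_plaqWord_sub_one_le)
open NE7CovariantInteriorGradientSharp (norm_cD_le_of_covLap_sharp)
open NE7GradientCurrencyCurved (norm_covLap_frame_le norm_gradMember_le_covFd)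
open NE7CurvedRemainderCodifferential (norm_codiff_siteCurl_le)

noncomputable section

variable {d : ℕ} {n : Type*} [Fintype n] [DecidableEq n]

/-! ## §1 The a priori gradient bound with the sharp curvature bookkeeping -/

/-- **THE A PRIORI FORM, SHARP**: under the data `J`, `P`, the sup `ρ`, the a priori covariant-gradient bound `G`, and `R ≥ 1`, every covariant forward difference of `A = frame W Z`
obeys `‖∇_τ A_ν(x₀)‖ ≤ 2(dρ∕R + R(B_ν + 2δρ + 4da(G + 2aρ) + 4da²ρ)) + 2aρ` with `B_ν = J + 8d(e^{4ρ}−1)(G + xρ) + 8dxρ + P + 2dxρ` (F117 + F120), `a = 2d(R+1)x`,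
`δ = 2d²(R+1)x₁ + 8d³(R+1)²x²` (F116b). [folklore] -/
theorem norm_cD_frame_le_apriori_sharp [Nonempty n] {W : Site d → Fin d → (Matrix n n ℂ)ˣ} (hW : IsUnitaryCfg W) {x x₁ : ℝ} (hx : 0 ≤ x) (hx₁ : 0 ≤ x₁) (hWx : SmallField W x)
    (hgrad : ∀ (p : Site d) (μ κ : Fin d), κ ≠ μ →
      ‖Ad (W p μ) ((hol W (p + e μ) (plaqWord κ μ) : (Matrix n n ℂ)ˣ) : Matrix n n ℂ) - ((hol W p (plaqWord κ μ) : (Matrix n n ℂ)ˣ) : Matrix n n ℂ)‖ ≤ x₁)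
    (Z : Site d → Fin d → Matrix n n ℂ) {ρ G J P : ℝ} (hZ : ∀ y κ, ‖Z y κ‖ ≤ ρ)
    (hG : ∀ (y : Site d) (τ κ : Fin d), ‖cD W τ (fun z => frame W Z z κ) y‖ ≤ G)
    (hJ : ∀ (y : Site d) (ν : Fin d), ‖∑ μ, cDstar W μ (fun z => ((hol (vary W Z 1) z (plaqWord μ ν) : (Matrix n n ℂ)ˣ) : Matrix n n ℂ)
        * (((hol W z (plaqWord μ ν))⁻¹ : (Matrix n n ℂ)ˣ) : Matrix n n ℂ) - 1) y‖ ≤ J)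
    (hP : ∀ (y : Site d) (ν : Fin d), ‖cD W ν (covDiv W Z) y‖ ≤ P) {R : ℕ} (hR : 1 ≤ R) (x₀ : Site d) (τ ν : Fin d) :
    ‖cD W τ (fun y => frame W Z y ν) x₀‖ ≤ 2 * ((d : ℝ) * ρ / R + R * (((J + 8 * d * (Real.exp (4 * ρ) - 1) * (G + x * ρ) + 8 * d * (x * ρ)) + P + 2 * d * x * ρ) + 2 * (2 * (d : ℝ) ^ 2 * (R + 1) * x₁ + 8 * (d : ℝ) ^ 3 * ((R : ℝ) + 1) ^ 2 * x ^ 2) * ρ + 4 * (d : ℝ) * (2 * (d : ℝ) * (R + 1) * x) * (G + 2 * (2 * (d : ℝ) * (R + 1) * x) * ρ) + 4 * (d : ℝ) * (2 * (d : ℝ) * (R + 1) * x) ^ 2 * ρ)) + 2 * (2 * (d : ℝ) * (R + 1) * x) * ρ :=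
  norm_cD_le_of_covLap_sharp hW hx hx₁ hWx hgrad (fun y => frame W Z y ν) (fun y => by rw [norm_frame hW]; exact hZ y ν) (fun y τ' => hG y τ' ν)
    (fun y => norm_covLap_frame_le hW hx hWx Z hZ hG hJ hP y ν) hR x₀ τ

/-! ## §2 On the torus: the maximal covariant difference is absorbed -/

/-- **THE GRADIENT CURRENCY FROM THE SUP CURRENCY AT A CURVED BACKGROUND, SHARP, SITE-FRAMED FORM.**  For `d ≥ 1`, unitary `Per`-periodic `W` (`Per ≥ 1`) with `SmallField W x`
and covariant plaquette gradients `≤ x₁`, `Per`-periodic `Z` with `‖Z‖ ≤ ρ`, the data `J`, `P`, and `R ≥ 1` with `16dR·a + 32dR(e^{4ρ} − 1) ≤ 1` (`a = 2d(R+1)x`):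
`‖∇_τ (frame W Z)_ν (x)‖ ≤ 4(dρ∕R + R(J + P)) + (4R(8d(e^{4ρ}−1)x + 10dx + 2δ + 12da²) + 4a)·ρ`. [folklore] -/
theorem norm_cD_frame_le_periodic_sharp [Nonempty n] (hd : 1 ≤ d) {Per : ℕ} (hPer : 1 ≤ Per)
    {W : Site d → Fin d → (Matrix n n ℂ)ˣ} (hW : IsUnitaryCfg W) {x x₁ : ℝ} (hx : 0 ≤ x) (hx₁ : 0 ≤ x₁) (hWx : SmallField W x)
    (hgrad : ∀ (p : Site d) (μ κ : Fin d), κ ≠ μ →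
      ‖Ad (W p μ) ((hol W (p + e μ) (plaqWord κ μ) : (Matrix n n ℂ)ˣ) : Matrix n n ℂ) - ((hol W p (plaqWord κ μ) : (Matrix n n ℂ)ˣ) : Matrix n n ℂ)‖ ≤ x₁) (hWP : IsPeriodicCfg W (Per : ℤ))
    (Z : Site d → Fin d → Matrix n n ℂ) (hZP : IsPeriodicDir Z (Per : ℤ)) {ρ J P : ℝ} (hZ : ∀ y κ, ‖Z y κ‖ ≤ ρ)
    (hJ : ∀ (y : Site d) (ν : Fin d), ‖∑ μ, cDstar W μ (fun z => ((hol (vary W Z 1) z (plaqWord μ ν) : (Matrix n n ℂ)ˣ) : Matrix n n ℂ)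
        * (((hol W z (plaqWord μ ν))⁻¹ : (Matrix n n ℂ)ˣ) : Matrix n n ℂ) - 1) y‖ ≤ J)
    (hP : ∀ (y : Site d) (ν : Fin d), ‖cD W ν (covDiv W Z) y‖ ≤ P)
    {R : ℕ} (hR : 1 ≤ R) (hsmall : 16 * (d : ℝ) * R * (2 * (d : ℝ) * (R + 1) * x) + 32 * (d : ℝ) * R * (Real.exp (4 * ρ) - 1) ≤ 1) (x' : Site d) (τ ν : Fin d) :
    ‖cD W τ (fun y => frame W Z y ν) x'‖ ≤ 4 * ((d : ℝ) * ρ / R + R * (J + P)) + (4 * R * (8 * d * (Real.exp (4 * ρ) - 1) * x + 10 * d * x + 2 * (2 * (d : ℝ) ^ 2 * (R + 1) * x₁ + 8 * (d : ℝ) ^ 3 * ((R : ℝ) + 1) ^ 2 * x ^ 2) + 12 * d * (2 * (d : ℝ) * (R + 1) * x) ^ 2) + 4 * (2 * (d : ℝ) * (R + 1) * x)) * ρ := by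
  classical
  -- the maximal covariant forward difference over one period
  set S : Finset (Site d × Fin d × Fin d) :=
    (periodBox (d := d) Per) ×ˢ ((Finset.univ : Finset (Fin d)) ×ˢ (Finset.univ : Finset (Fin d))) with hS_def
  have hmemS : ∀ (y : Site d) (i j : Fin d), (cmod Per y, i, j) ∈ S := fun y i j => by
    rw [hS_def, Finset.mem_product, Finset.mem_product]
    exact ⟨(mem_periodBox).2 fun k => ⟨cmod_nonneg hPer y k, cmod_lt hPer y k⟩, Finset.mem_univ _, Finset.mem_univ _⟩
  have hSne : S.Nonempty := ⟨_, hmemS 0 ⟨0, hd⟩ ⟨0, hd⟩⟩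
  obtain ⟨q₀, -, hq₀max⟩ := Finset.exists_max_image S (fun q => ‖cD W q.2.2 (fun z => frame W Z z q.2.1) q.1‖) hSne
  set G : ℝ := ‖cD W q₀.2.2 (fun z => frame W Z z q₀.2.1) q₀.1‖ with hG_def
  have hper : ∀ (i j : Fin d) (y : Site d) (k : Fin d), cD W j (fun z => frame W Z z i) (y + (Per : ℤ) • e k) = cD W j (fun z => frame W Z z i) y :=
    fun i j y k => cD_periodic hWP j (fun z k' => frame_periodic hWP hZP z k' i) y k
  have hGall : ∀ (y : Site d) (j i : Fin d), ‖cD W j (fun z => frame W Z z i) y‖ ≤ G := by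
    intro y j i
    have hy : y = cmod Per y + (Per : ℤ) • SkeletonLattice.cdiv Per y := by rw [add_comm, smul_cdiv_add_cmod]
    have h1 : cD W j (fun z => frame W Z z i) y = cD W j (fun z => frame W Z z i) (cmod Per y) := by
      have h := periodic_smul_vec (f := fun z => cD W j (fun z => frame W Z z i) z) (N := (Per : ℤ)) (hper i j) (cmod Per y) (SkeletonLattice.cdiv Per y)
      rwa [← hy] at h
    rw [h1]
    have hm := hq₀max (cmod Per y, i, j) (hmemS y i j)
    simpa only using hm
  -- §1 at the maximising bond, then absorb
  have hkey := norm_cD_frame_le_apriori_sharp hW hx hx₁ hWx hgrad Z hZ (fun y τ' κ => hGall y τ' κ) hJ hP hR q₀.1 q₀.2.2 q₀.2.1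
  rw [← hG_def] at hkey
  have hR1 : (1 : ℝ) ≤ R := by exact_mod_cast hR
  have hρ0 : 0 ≤ ρ := (norm_nonneg _).trans (hZ 0 ⟨0, hd⟩)
  have hE : 0 ≤ (Real.exp (4 * ρ) - 1) := by have := Real.one_le_exp (by positivity : 0 ≤ 4 * ρ); linarith
  have hG0 : 0 ≤ G := norm_nonneg _
  have hJ0 : 0 ≤ J := (norm_nonneg _).trans (hJ 0 ⟨0, hd⟩)
  have hP0 : 0 ≤ P := (norm_nonneg _).trans (hP 0 ⟨0, hd⟩)
  have ha0 : 0 ≤ (2 * (d : ℝ) * (R + 1) * x) := by positivity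
  -- split the a priori bound into the `G`-free part and the `G`-part
  have hsplit : 2 * ((d : ℝ) * ρ / R + R * (((J + 8 * d * (Real.exp (4 * ρ) - 1) * (G + x * ρ) + 8 * d * (x * ρ)) + P + 2 * d * x * ρ) + 2 * (2 * (d : ℝ) ^ 2 * (R + 1) * x₁ + 8 * (d : ℝ) ^ 3 * ((R : ℝ) + 1) ^ 2 * x ^ 2) * ρ + 4 * (d : ℝ) * (2 * (d : ℝ) * (R + 1) * x) * (G + 2 * (2 * (d : ℝ) * (R + 1) * x) * ρ) + 4 * (d : ℝ) * (2 * (d : ℝ) * (R + 1) * x) ^ 2 * ρ)) + 2 * (2 * (d : ℝ) * (R + 1) * x) * ρ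
      = (2 * ((d : ℝ) * ρ / R + R * (J + P)) + (2 * R * (8 * d * (Real.exp (4 * ρ) - 1) * x + 10 * d * x + 2 * (2 * (d : ℝ) ^ 2 * (R + 1) * x₁ + 8 * (d : ℝ) ^ 3 * ((R : ℝ) + 1) ^ 2 * x ^ 2) + 12 * d * (2 * (d : ℝ) * (R + 1) * x) ^ 2) + 2 * (2 * (d : ℝ) * (R + 1) * x)) * ρ)
        + G * (16 * (d : ℝ) * R * (Real.exp (4 * ρ) - 1) + 8 * R * (d : ℝ) * (2 * (d : ℝ) * (R + 1) * x)) := by ring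
  rw [hsplit] at hkey
  have habs : G * (16 * (d : ℝ) * R * (Real.exp (4 * ρ) - 1) + 8 * R * (d : ℝ) * (2 * (d : ℝ) * (R + 1) * x)) ≤ G * 1 := by
    refine mul_le_mul_of_nonneg_left ?_ hG0
    nlinarith
  have hGle : G ≤ 4 * ((d : ℝ) * ρ / R + R * (J + P)) + (4 * R * (8 * d * (Real.exp (4 * ρ) - 1) * x + 10 * d * x + 2 * (2 * (d : ℝ) ^ 2 * (R + 1) * x₁ + 8 * (d : ℝ) ^ 3 * ((R : ℝ) + 1) ^ 2 * x ^ 2) + 12 * d * (2 * (d : ℝ) * (R + 1) * x) ^ 2) + 4 * (2 * (d : ℝ) * (R + 1) * x)) * ρ := by nlinarith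
  exact (hGall x' τ ν).trans hGle

/-! ## §3 The END-framed readings -/

/-- **SHARP, ROW NE3-R2 FORM**: `‖covFd W Z x τ ν‖ ≤ 4(dρ∕R + R(J + P)) + (4R(8d(e^{4ρ}−1)x + 10dx + 2δ + 12da²) + 4a)·ρ`. [folklore] -/
theorem norm_covFd_le_periodic_sharp [Nonempty n] (hd : 1 ≤ d) {Per : ℕ} (hPer : 1 ≤ Per)
    {W : Site d → Fin d → (Matrix n n ℂ)ˣ} (hW : IsUnitaryCfg W) {x x₁ : ℝ} (hx : 0 ≤ x) (hx₁ : 0 ≤ x₁) (hWx : SmallField W x)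
    (hgrad : ∀ (p : Site d) (μ κ : Fin d), κ ≠ μ →
      ‖Ad (W p μ) ((hol W (p + e μ) (plaqWord κ μ) : (Matrix n n ℂ)ˣ) : Matrix n n ℂ) - ((hol W p (plaqWord κ μ) : (Matrix n n ℂ)ˣ) : Matrix n n ℂ)‖ ≤ x₁) (hWP : IsPeriodicCfg W (Per : ℤ))
    (Z : Site d → Fin d → Matrix n n ℂ) (hZP : IsPeriodicDir Z (Per : ℤ)) {ρ J P : ℝ} (hZ : ∀ y κ, ‖Z y κ‖ ≤ ρ)
    (hJ : ∀ (y : Site d) (ν : Fin d), ‖∑ μ, cDstar W μ (fun z => ((hol (vary W Z 1) z (plaqWord μ ν) : (Matrix n n ℂ)ˣ) : Matrix n n ℂ)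
        * (((hol W z (plaqWord μ ν))⁻¹ : (Matrix n n ℂ)ˣ) : Matrix n n ℂ) - 1) y‖ ≤ J)
    (hP : ∀ (y : Site d) (ν : Fin d), ‖cD W ν (covDiv W Z) y‖ ≤ P)
    {R : ℕ} (hR : 1 ≤ R) (hsmall : 16 * (d : ℝ) * R * (2 * (d : ℝ) * (R + 1) * x) + 32 * (d : ℝ) * R * (Real.exp (4 * ρ) - 1) ≤ 1) (x' : Site d) (τ ν : Fin d) :
    ‖covFd W Z x' τ ν‖ ≤ 4 * ((d : ℝ) * ρ / R + R * (J + P)) + (4 * R * (8 * d * (Real.exp (4 * ρ) - 1) * x + 10 * d * x + 2 * (2 * (d : ℝ) ^ 2 * (R + 1) * x₁ + 8 * (d : ℝ) ^ 3 * ((R : ℝ) + 1) ^ 2 * x ^ 2) + 12 * d * (2 * (d : ℝ) * (R + 1) * x) ^ 2) + 4 * (2 * (d : ℝ) * (R + 1) * x)) * ρ := by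
  rw [← cD_frame]
  exact norm_cD_frame_le_periodic_sharp hd hPer hW hx hx₁ hWx hgrad hWP Z hZP hZ hJ hP hR hsmall x' τ ν

/-- **SHARP, F115's `hGradZ` FORM**: `‖Ad_{W(y+e_κ,τ)}Z(y+e_τ,κ) − Z(y,κ)‖ ≤ 4(dρ∕R + R(J + P)) + (4R(8d(e^{4ρ}−1)x + 10dx + 2δ + 12da²) + 4a)·ρ + 2xρ`. [folklore] -/
theorem norm_gradMember_le_periodic_sharp [Nonempty n] (hd : 1 ≤ d) {Per : ℕ} (hPer : 1 ≤ Per)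
    {W : Site d → Fin d → (Matrix n n ℂ)ˣ} (hW : IsUnitaryCfg W) {x x₁ : ℝ} (hx : 0 ≤ x) (hx₁ : 0 ≤ x₁) (hWx : SmallField W x)
    (hgrad : ∀ (p : Site d) (μ κ : Fin d), κ ≠ μ →
      ‖Ad (W p μ) ((hol W (p + e μ) (plaqWord κ μ) : (Matrix n n ℂ)ˣ) : Matrix n n ℂ) - ((hol W p (plaqWord κ μ) : (Matrix n n ℂ)ˣ) : Matrix n n ℂ)‖ ≤ x₁) (hWP : IsPeriodicCfg W (Per : ℤ))
    (Z : Site d → Fin d → Matrix n n ℂ) (hZP : IsPeriodicDir Z (Per : ℤ)) {ρ J P : ℝ} (hZ : ∀ y κ, ‖Z y κ‖ ≤ ρ)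
    (hJ : ∀ (y : Site d) (ν : Fin d), ‖∑ μ, cDstar W μ (fun z => ((hol (vary W Z 1) z (plaqWord μ ν) : (Matrix n n ℂ)ˣ) : Matrix n n ℂ)
        * (((hol W z (plaqWord μ ν))⁻¹ : (Matrix n n ℂ)ˣ) : Matrix n n ℂ) - 1) y‖ ≤ J)
    (hP : ∀ (y : Site d) (ν : Fin d), ‖cD W ν (covDiv W Z) y‖ ≤ P)
    {R : ℕ} (hR : 1 ≤ R) (hsmall : 16 * (d : ℝ) * R * (2 * (d : ℝ) * (R + 1) * x) + 32 * (d : ℝ) * R * (Real.exp (4 * ρ) - 1) ≤ 1) (y : Site d) (κ τ : Fin d) :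
    ‖Ad (W (y + e κ) τ) (Z (y + e τ) κ) - Z y κ‖ ≤ 4 * ((d : ℝ) * ρ / R + R * (J + P)) + (4 * R * (8 * d * (Real.exp (4 * ρ) - 1) * x + 10 * d * x + 2 * (2 * (d : ℝ) ^ 2 * (R + 1) * x₁ + 8 * (d : ℝ) ^ 3 * ((R : ℝ) + 1) ^ 2 * x ^ 2) + 12 * d * (2 * (d : ℝ) * (R + 1) * x) ^ 2) + 4 * (2 * (d : ℝ) * (R + 1) * x)) * ρ + 2 * x * ρ := by
  refine (norm_gradMember_le_covFd hW Z y τ κ (norm_hol_plaqWord_sub_one_le hx hWx y τ κ)).trans ?_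
  exact add_le_add (norm_covFd_le_periodic_sharp hd hPer hW hx hx₁ hWx hgrad hWP Z hZP hZ hJ hP hR hsmall y τ κ)
    (mul_le_mul_of_nonneg_left (hZ _ _) (by positivity))

end

end Summit.QuantumFields.BalabanUV.T4Continuum.NE7GradientCurrencyCurvedSharp
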